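import Summits.ResolutionOfSingularities.ResolutionOfSingularities.Theorems.FrobeniusLadderFInjectiveMacaulayficationSliceableCentre
import Mathlib.Algebra.Polynomial.Laurent
import HarnessLib

/-!
# GDD — good divisorial degeneration data: the DEFINITIONS (multiplicative filtrations, extended Rees algebra, punctured cone, `GDD`)
# (crux `FInjectiveMacaulayfication` stmt-ResolutionOfSingularities-15315, chain w45a; THEOREM-D / THEOREM Q programme of res-L1-w45a-idea-1 + strat-1)

[OURS · L1 W4.5a] Definition file (review lane). The SORRY-FREE definitional core (§1 + the definition `GDD`) of res-L1-w45a-idea-1's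
`ThmDSig.lean` r14 `5c2fa033f563a237` (tri-2 REFEREE = S, 0 false signatures, 2026-08-27T18:47:17Z; plan-1 R15.38), filed verbatim by
res-L1-w45a-lead-1 (RULING R15.36 (2): task (C) `gdd_of_isolatedSingularity_dimThree` needs `GDD` in the tree) under the namespace
`…Theorems.FInjectiveMacaulayfication.GDD`. NOT a statement of any manuscript; AI-written, weaker than expert review. The sorried claims of the
Sig (Veronese bridges, THEOREM Q, Lemma 2/S/T, COR D1, ThmD-3, Ψ) are NOT here — they remain typed targets in the Sig.

Contents: `MultFiltration` (decreasing multiplicative filtrations of ideals), `reesGens` / `extRees` (extended Rees algebra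
`R[I_nTⁿ, T⁻¹] ⊆ R[T;T⁻¹]`), `sInv = T⁻¹`, `homog`, `assocGraded = 𝓡(F)/(T⁻¹)`, `homogBar`, `PuncturedFull p F` (the punctured cone
`Spec G(F) ∖ V(G₊)` satisfies the CM clause and the F-clause at closed points, in the tree's `SliceableCentre.CMCl` / `FCl` currency),
`IsVeronese`, `reesAlg`, and `GDD p R` (an `𝔪`-primary multiplicative filtration with a Veronese exponent whose associated graded ring is
FULL off `V(G₊)`). [folklore definitions; the notion GDD is strat-1's ROUTES-DIM4 §1-quater, this typing idea-1's]
-/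

-- single-problem summit: the doubled namespace component is forced
set_option linter.dupNamespace false
set_option autoImplicit false

noncomputable section

namespace Summit.ResolutionOfSingularities.ResolutionOfSingularities.Theorems.FInjectiveMacaulayfication.GDD

open Summit.ResolutionOfSingularities.ResolutionOfSingularities.Theorems.FInjectiveMacaulayfication
open IsLocalRing

/-! ## §1 Multiplicative filtrations, extended Rees algebra, punctured cone, GDD -/

/-- A decreasing multiplicative filtration `R = I₀ ⊇ I₁ ⊇ I₂ ⊇ …` of ideals with `I_m·I_n ⊆ I_{m+n}`. [folklore] -/
structure MultFiltration (R : Type) [CommRing R] where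
  /-- the `n`-th piece -/
  I : ℕ → Ideal R
  I_zero : I 0 = ⊤
  antitone : Antitone I
  mul_le : ∀ m n : ℕ, I m * I n ≤ I (m + n)

variable {R : Type} [CommRing R]

/-- Generators of the extended Rees algebra: `T⁻¹` and the elements `a·Tⁿ`, `a ∈ I_n`. -/
def reesGens (F : MultFiltration R) : Set (LaurentPolynomial R) :=
  {LaurentPolynomial.T (-1)} ∪ ⋃ n : ℕ, (fun a : R => LaurentPolynomial.C a * LaurentPolynomial.T (n : ℤ)) '' (F.I n : Set R)

/-- The EXTENDED REES ALGEBRA `𝓡(F) = R[I_n Tⁿ, T⁻¹] ⊆ R[T;T⁻¹]`, in adjoin form (for a multiplicative filtration it is the set of Laurent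
polynomials whose `n`-th coefficient lies in `I_n` for `n > 0`). [folklore] -/
def extRees (F : MultFiltration R) : Subalgebra R (LaurentPolynomial R) :=
  Algebra.adjoin R (reesGens F)

/-- `T⁻¹ ∈ 𝓡(F)`. -/
theorem T_neg_one_mem (F : MultFiltration R) : LaurentPolynomial.T (-1) ∈ extRees F :=
  Algebra.subset_adjoin (Set.mem_union_left _ (Set.mem_singleton _))

/-- `a·Tᴺ ∈ 𝓡(F)` for `a ∈ I_N`. -/
theorem homog_mem (F : MultFiltration R) (N : ℕ) (a : R) (ha : a ∈ F.I N) :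
    LaurentPolynomial.C a * LaurentPolynomial.T (N : ℤ) ∈ extRees F :=
  Algebra.subset_adjoin (Set.mem_union_right _ (Set.mem_iUnion.mpr ⟨N, ⟨a, ha, rfl⟩⟩))

/-- The deformation parameter `s = T⁻¹ ∈ 𝓡(F)`. -/
def sInv (F : MultFiltration R) : extRees F := ⟨LaurentPolynomial.T (-1), T_neg_one_mem F⟩

/-- The homogeneous element `a·Tᴺ ∈ 𝓡(F)` of degree `N`, `a ∈ I_N`. -/
def homog (F : MultFiltration R) (N : ℕ) (a : R) (ha : a ∈ F.I N) : extRees F :=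
  ⟨LaurentPolynomial.C a * LaurentPolynomial.T (N : ℤ), homog_mem F N a ha⟩

/-- The ASSOCIATED GRADED RING `G(F) = 𝓡(F)/(T⁻¹) = ⊕ I_n/I_{n+1}` — the special fibre of the degeneration `Spec 𝓡(F) → Spec R[T⁻¹]`. [folklore] -/
abbrev assocGraded (F : MultFiltration R) : Type := ↥(extRees F) ⧸ Ideal.span {sInv F}

/-- The image `ā·Tᴺ ∈ G(F)` of a homogeneous element of positive degree. -/
def homogBar (F : MultFiltration R) (N : ℕ) (a : R) (ha : a ∈ F.I N) : assocGraded F :=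
  Ideal.Quotient.mk (Ideal.span {sInv F}) (homog F N a ha)

/-- **The punctured cone is FULL**: at every closed point of every basic open `D₊(ā·Tᴺ)` (`N ≥ 1`, `a ∈ I_N`) of `Spec G(F)` — i.e. at every
prime of `G(F)` not containing `G₊` — the CM clause and the F-clause of the crux hold (CM and F-injectivity localise, so closed points suffice).
This is strat-1's «`G` FULL at every prime `𝔓 ⊉ G₊`» (ROUTES-DIM4 §1-quater), domain-ness not required of a cone. [OURS typing] -/
def PuncturedFull (p : ℕ) (F : MultFiltration R) : Prop :=
  ∀ (N : ℕ), 0 < N → ∀ (a : R) (ha : a ∈ F.I N),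
    ∀ (𝔐 : Ideal (Localization.Away (homogBar F N a ha))) [𝔐.IsMaximal],
      SliceableCentre.CMCl (Localization.AtPrime 𝔐) ∧ SliceableCentre.FCl p (Localization.AtPrime 𝔐)

/-- `N ≥ 1` is a Veronese exponent: `I_{kN} = (I_N)ᵏ` for all `k`.  For Noetherian `R` this is equivalent to finite generation of the Rees
algebra `⊕ I_n Tⁿ` (Bourbaki, Alg. Comm. III §1.3 Prop. 3 ⟹; ⟸: `⊕_k I_{kN+i}` is an ideal of `R[I_N T]` up to shift), and it is the form the
engine consumes (the centre is `I_N`, the `N`-th Veronese of `𝓡(F)` is `R[I_N Tᴺ, T⁻ᴺ]`). [folklore] -/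
def IsVeronese (F : MultFiltration R) (N : ℕ) : Prop := 0 < N ∧ ∀ k : ℕ, F.I (k * N) = F.I N ^ k

/-- The (ordinary) Rees algebra `𝓐(F) = R[I_n Tⁿ : n ≥ 1] ⊆ R[T;T⁻¹]` (strat-1's `𝓐 = ⊕_{n≥0} I_n`). [folklore] -/
def reesAlg (F : MultFiltration R) : Subalgebra R (LaurentPolynomial R) :=
  Algebra.adjoin R (⋃ n : ℕ, (fun a : R => LaurentPolynomial.C a * LaurentPolynomial.T (n : ℤ)) '' (F.I n : Set R))

/-- **GDD (good divisorial degeneration datum; strat-1 ROUTES-DIM4 v1.2 §1-quater, ring level).**  A local ring `R` has GDD if it carries an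
`𝔪`-primary multiplicative filtration (`√I₁ = 𝔪`, hence `√I_n = 𝔪` for `n ≥ 1`) with finitely generated Rees algebra (typed: a Veronese
exponent — equivalent by the Sig's `exists_isVeronese_of_fg` / `fg_of_isVeronese`) whose associated graded ring is FULL off `V(G₊)`.
JUNK NOTE (res-L1-w45a-tri-2 REFEREE 2026-08-27T18:47:17Z, sharpened): `GDD p R` is TRIVIALLY TRUE for an ARTINIAN local `R` (in particular a
field) via the zero filtration `I_n = 0` (`n ≥ 1`) — `√0 = 𝔪`, Veronese, and the punctured cone is empty; every use in the programme carries
`dim R ≥ 1` / `𝔭 ≠ ⊥`, where the condition has content. [OURS · strat-1's definition (ROUTES-DIM4 §1-quater), idea-1's typing] -/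
def GDD (p : ℕ) (R : Type) [CommRing R] [IsLocalRing R] : Prop :=
  ∃ F : MultFiltration R, (F.I 1).radical = maximalIdeal R ∧ (∃ N : ℕ, IsVeronese F N) ∧ PuncturedFull p F


end Summit.ResolutionOfSingularities.ResolutionOfSingularities.Theorems.FInjectiveMacaulayfication.GDD
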